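import Summits.QuantumFields.YangMills.Theorems.CurvatureBoostCovariance.Negative.Unbundled
import Summits.QuantumFields.YangMills.Theorems.NPointIsotropy.Negative.NPointRegularJunk
import Summits.QuantumFields.YangMills.Theorems.MirrorModularBoostsCurvatureBoostCovarianceRayPositivityCore
import Summits.QuantumFields.YangMills.Theorems.MirrorModularBoostsPlanarSpectralConeDensityHelpers
import Literature.MathematicalPhysics.QuantumFieldTheory.OSReconstructionNoE1

/-!
# Assembly piece G2 — small rotations keep time-ordering; rotated centres of jointly localised configurations

Line `Sketch` of crux `MirrorModularBoosts.SoftKernelBoostCovariance` (stmt-QuantumFields-14999): a piece of the LEAD'S ASSEMBLY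
(T7, `stub_chainAssembly` of the registered skeleton `Cruxes/SoftKernelBoostCovariance/Lines/Sketch.lean` + `Lines/SketchAsm.lean`),
landed under the registered conjunction `stub_asmGeometryRot` (helper package; the assembly's later pieces import this module).

Exported: `isTimeOrdered_rot_of_margins` (`|θ| < δ/(4L)`) and `centres_rot` (rotated times `≥ δ`, consecutive `≥ δ/2`).
-/

noncomputable section

namespace Summit.QuantumFields.YangMills.Theorems.SoftKernelBoostCovariance.Sketch

open scoped BigOperators SchwartzMap InnerProductSpace
open MeasureTheory Filter Topology
open Literature.MathematicalPhysics.QuantumLattice Literature.MathematicalPhysics.AQFT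
  Literature.MathematicalPhysics.QuantumFieldTheory
open Summit.QuantumFields.YangMills.Theorems.NPointIsotropy.Negative (E4)
open Summit.QuantumFields.YangMills.Theorems.CurvatureBoostCovariance.Negative
  (OSPackage Translations Hypercubic EightFrameRP PlanarCone PlanarInvariant)
open Summit.QuantumFields.YangMills.Cruxes.PlanarSpectralCone.PositivityDiscToOperatorCone.Density
  (isTimeOrdered_add fieldVec_add fieldVec_smul fieldVec_congr fieldVec_zero tendsto_fieldVec)

/-- Elementary bounds for small angles: `cos θ ≥ 3/4` and `|sin θ| ≤ |θ|` for `|θ| ≤ 1/2`. -/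
theorem cos_ge_three_quarters {θ : ℝ} (hθ : |θ| ≤ 1 / 2) : 3 / 4 ≤ Real.cos θ := by
  have h1 : 1 - θ ^ 2 / 2 ≤ Real.cos θ := Real.one_sub_sq_div_two_le_cos
  have h2 : θ ^ 2 ≤ 1 / 4 := by
    have : θ ^ 2 = |θ| ^ 2 := (sq_abs θ).symm
    rw [this]; nlinarith [abs_nonneg θ]
  linarith

/-- **Rotated planar coordinates stay close**: for `|θ| ≤ ε ≤ 1/2` and `|c₁|, |c₂| ≤ L'`,
`cos θ c₁ + sin θ c₂ ≥ (3/4) c₁ - ε L'` when `c₁ ≥ 0`, and the rotated first coordinate of a difference is bounded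
below by `(3/4)(c₁ - c₁') - 2 ε L'`. -/
theorem rot_fst_ge {θ ε L' c₁ c₂ : ℝ} (hθ : |θ| ≤ ε) (hε : ε ≤ 1 / 2) (hc₁ : 0 ≤ c₁) (hc₂ : |c₂| ≤ L') :
    3 / 4 * c₁ - ε * L' ≤ Real.cos θ * c₁ + Real.sin θ * c₂ := by
  have hcos := cos_ge_three_quarters (hθ.trans hε)
  have hsin : |Real.sin θ| ≤ ε := (Real.abs_sin_le_abs).trans hθ
  have h1 : 3 / 4 * c₁ ≤ Real.cos θ * c₁ := mul_le_mul_of_nonneg_right hcos hc₁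
  have h2 : |Real.sin θ * c₂| ≤ ε * L' := by
    rw [abs_mul]; exact mul_le_mul hsin hc₂ (abs_nonneg _) ((abs_nonneg _).trans hθ)
  have h3 := neg_abs_le (Real.sin θ * c₂)
  linarith

/-- Coordinates of the plane rotation on `ℝ⁴`: the rotated time. -/
theorem planeRot_apply_zero (θ : ℝ) (y : E4) :
    planeRot (0 : Fin 3) θ y 0 = Real.cos θ * y 0 + Real.sin θ * y 1 := by
  simp [planeRot_apply]

/-- Points of the support of `R_θ · F` are rotated points of the support of `F`. -/
theorem mem_tsupport_of_linActMulti {n : ℕ} (F : 𝓢((Fin n → E4), ℂ)) (θ : ℝ) {x : Fin n → E4}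
    (hx : x ∈ tsupport ((linActMulti (planeRot (0 : Fin 3) θ) F : 𝓢((Fin n → E4), ℂ)) : (Fin n → E4) → ℂ)) :
    (fun i => (planeRot (0 : Fin 3) θ).symm (x i)) ∈ tsupport (F : (Fin n → E4) → ℂ) ∧
      ∀ i, x i = planeRot (0 : Fin 3) θ ((planeRot (0 : Fin 3) θ).symm (x i)) := by
  set Lm : (Fin n → E4) → (Fin n → E4) := fun x i => (planeRot (0 : Fin 3) θ).symm (x i)
  have hLc : Continuous Lm := continuous_pi fun i => (planeRot (0 : Fin 3) θ).symm.continuous.comp (continuous_apply i)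
  have hcoe : ((linActMulti (planeRot (0 : Fin 3) θ) F : 𝓢((Fin n → E4), ℂ)) : (Fin n → E4) → ℂ) =
      (F : (Fin n → E4) → ℂ) ∘ Lm := by
    funext y; simp [Lm, linActMulti_apply]
  rw [hcoe] at hx
  exact ⟨tsupport_comp_subset_preimage _ hLc hx, fun i => by simp⟩

/-- **Small rotations of a compactly supported time-ordered function are time-ordered** (quantitative: `|θ| < δ/(4L)`
with the margins of `geom_margins`). -/
theorem isTimeOrdered_rot_of_margins {n : ℕ} {F : 𝓢((Fin n → E4), ℂ)} {δ L : ℝ} (hδ : 0 < δ) (hδ1 : δ ≤ 1) (hL : 1 ≤ L)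
    (hK : ∀ x ∈ tsupport (F : (Fin n → E4) → ℂ),
      (∀ j : Fin n, 4 * δ ≤ x j 0) ∧ (∀ i j : Fin n, i < j → 4 * δ ≤ x j 0 - x i 0) ∧
      (∀ (j : Fin n) (k : Fin 4), |x j k| ≤ L))
    {θ : ℝ} (hθ : |θ| < δ / (4 * L)) : IsTimeOrdered (linActMulti (planeRot (0 : Fin 3) θ) F) := by
  intro x hx
  obtain ⟨hy, hxy⟩ := mem_tsupport_of_linActMulti F θ hx
  set y : Fin n → E4 := fun i => (planeRot (0 : Fin 3) θ).symm (x i)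
  obtain ⟨ht, hg, hc⟩ := hK y hy
  have hε : δ / (4 * L) ≤ 1 / 2 := by
    rw [div_le_iff₀ (by positivity)]; nlinarith
  have hθ' : |θ| ≤ δ / (4 * L) := hθ.le
  have hx0 : ∀ i, x i 0 = Real.cos θ * y i 0 + Real.sin θ * y i 1 := fun i => by
    rw [hxy i, planeRot_apply_zero]
  have hεL : δ / (4 * L) * L = δ / 4 := by field_simp
  refine ⟨fun i => ?_, fun i j hij => ?_⟩
  · rw [hx0]
    have := rot_fst_ge (c₁ := y i 0) (c₂ := y i 1) hθ' hε (by linarith [ht i]) (hc i 1)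
    rw [hεL] at this
    linarith [ht i]
  · show x i 0 < x j 0
    rw [hx0, hx0]
    have h2 : |y j 1 - y i 1| ≤ 2 * L := by
      have := hc j 1; have := hc i 1
      calc |y j 1 - y i 1| ≤ |y j 1| + |y i 1| := abs_sub _ _
        _ ≤ 2 * L := by linarith
    have := rot_fst_ge (c₁ := y j 0 - y i 0) (c₂ := y j 1 - y i 1) (L' := 2 * L) hθ' hε (by linarith [hg i j hij]) h2
    have hεL2 : δ / (4 * L) * (2 * L) = δ / 2 := by field_simp; ring
    rw [hεL2] at this
    have hg' := hg i j hij
    nlinarith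

/-- **Rotated centres of a jointly localised configuration**: if every planar centre `c j` is within `δ` of the
planar coordinates of ONE support point of `F` (margins `4δ`, coordinates `≤ L`), then for `|θ| < δ/(4L)` the rotated
times are `≥ δ`, consecutive rotated times differ by `≥ δ/2`, and the centres are bounded by `L + 1`. -/
theorem centres_rot {n : ℕ} {F : 𝓢((Fin n → E4), ℂ)} {δ L : ℝ} (hδ : 0 < δ) (hδ1 : δ ≤ 1) (hL : 1 ≤ L)
    (hK : ∀ x ∈ tsupport (F : (Fin n → E4) → ℂ),
      (∀ j : Fin n, 4 * δ ≤ x j 0) ∧ (∀ i j : Fin n, i < j → 4 * δ ≤ x j 0 - x i 0) ∧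
      (∀ (j : Fin n) (k : Fin 4), |x j k| ≤ L))
    {c : Fin n → ℝ × ℝ}
    (hc : ∃ x ∈ tsupport (F : (Fin n → E4) → ℂ), ∀ j : Fin n, |(c j).1 - x j 0| ≤ δ ∧ |(c j).2 - x j 1| ≤ δ) :
    (∀ j : Fin n, |(c j).1| ≤ L + 1 ∧ |(c j).2| ≤ L + 1) ∧
    ∀ θ : ℝ, |θ| < δ / (4 * L) →
      (∀ j : Fin n, δ ≤ Real.cos θ * (c j).1 + Real.sin θ * (c j).2) ∧
      (∀ i j : Fin n, i < j →
        δ / 2 ≤ (Real.cos θ * (c j).1 + Real.sin θ * (c j).2) - (Real.cos θ * (c i).1 + Real.sin θ * (c i).2)) := by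
  obtain ⟨x, hx, hcx⟩ := hc
  obtain ⟨ht, hg, hco⟩ := hK x hx
  have hb : ∀ j : Fin n, |(c j).1| ≤ L + 1 ∧ |(c j).2| ≤ L + 1 := by
    intro j
    obtain ⟨h1, h2⟩ := hcx j
    have := hco j 0; have := hco j 1
    constructor
    · calc |(c j).1| = |((c j).1 - x j 0) + x j 0| := by ring_nf
        _ ≤ |(c j).1 - x j 0| + |x j 0| := abs_add_le _ _
        _ ≤ L + 1 := by linarith
    · calc |(c j).2| = |((c j).2 - x j 1) + x j 1| := by ring_nf
        _ ≤ |(c j).2 - x j 1| + |x j 1| := abs_add_le _ _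
        _ ≤ L + 1 := by linarith
  refine ⟨hb, fun θ hθ => ?_⟩
  have hε : δ / (4 * L) ≤ 1 / 2 := by
    rw [div_le_iff₀ (by positivity)]; nlinarith
  have hθ' : |θ| ≤ δ / (4 * L) := hθ.le
  have hq : δ / (4 * L) * (L + 1) ≤ δ / 2 := by
    rw [div_mul_eq_mul_div, div_le_iff₀ (by positivity)]; nlinarith
  refine ⟨fun j => ?_, fun i j hij => ?_⟩
  · obtain ⟨h1, h2⟩ := hcx j
    have hc1 : 3 * δ ≤ (c j).1 := by have := ht j; have := (abs_le.1 h1).1; linarith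
    have := rot_fst_ge (c₁ := (c j).1) (c₂ := (c j).2) (L' := L + 1) hθ' hε (by linarith) (hb j).2
    nlinarith
  · obtain ⟨hi1, hi2⟩ := hcx i
    obtain ⟨hj1, hj2⟩ := hcx j
    have hgap : 2 * δ ≤ (c j).1 - (c i).1 := by
      have := hg i j hij; have := (abs_le.1 hj1).1; have := (abs_le.1 hi1).2; linarith
    have h2 : |(c j).2 - (c i).2| ≤ 2 * (L + 1) := by
      calc |(c j).2 - (c i).2| ≤ |(c j).2| + |(c i).2| := abs_sub _ _
        _ ≤ 2 * (L + 1) := by linarith [(hb j).2, (hb i).2]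
    have := rot_fst_ge (c₁ := (c j).1 - (c i).1) (c₂ := (c j).2 - (c i).2) (L' := 2 * (L + 1)) hθ' hε
      (by linarith) h2
    nlinarith

/-- **Registered helper package `stub_asmGeometryRot` of the lead's assembly (line `Sketch`)**: the conjunction of
`isTimeOrdered_rot_of_margins`, `centres_rot`. -/
theorem stub_asmGeometryRot :
    open Literature.MathematicalPhysics.QuantumLattice Literature.MathematicalPhysics.AQFT
      Literature.MathematicalPhysics.QuantumFieldTheory
      Summit.QuantumFields.YangMills.Theorems.CurvatureBoostCovariance.Negative
      Summit.QuantumFields.YangMills.Theorems.NPointIsotropy.Negative in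
    (∀ {n : ℕ} {F : 𝓢((Fin n → E4), ℂ)} {δ L : ℝ} (hδ : 0 < δ) (hδ1 : δ ≤ 1) (hL : 1 ≤ L) (hK : ∀ x ∈ tsupport (F : (Fin n → E4) → ℂ), (∀ j : Fin n, 4 * δ ≤ x j 0) ∧ (∀ i j : Fin n, i < j → 4 * δ ≤ x j 0 - x i 0) ∧ (∀ (j : Fin n) (k : Fin 4), |x j k| ≤ L)) {θ : ℝ} (hθ : |θ| < δ / (4 * L)),
      IsTimeOrdered (linActMulti (planeRot (0 : Fin 3) θ) F)) ∧
    (∀ {n : ℕ} {F : 𝓢((Fin n → E4), ℂ)} {δ L : ℝ} (hδ : 0 < δ) (hδ1 : δ ≤ 1) (hL : 1 ≤ L) (hK : ∀ x ∈ tsupport (F : (Fin n → E4) → ℂ), (∀ j : Fin n, 4 * δ ≤ x j 0) ∧ (∀ i j : Fin n, i < j → 4 * δ ≤ x j 0 - x i 0) ∧ (∀ (j : Fin n) (k : Fin 4), |x j k| ≤ L)) {c : Fin n → ℝ × ℝ} (hc : ∃ x ∈ tsupport (F : (Fin n → E4) → ℂ), ∀ j : Fin n, |(c j).1 - x j 0|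 ≤ δ ∧ |(c j).2 - x j 1| ≤ δ),
      (∀ j : Fin n, |(c j).1| ≤ L + 1 ∧ |(c j).2| ≤ L + 1) ∧
        ∀ θ : ℝ, |θ| < δ / (4 * L) →
          (∀ j : Fin n, δ ≤ Real.cos θ * (c j).1 + Real.sin θ * (c j).2) ∧
          (∀ i j : Fin n, i < j →
            δ / 2 ≤ (Real.cos θ * (c j).1 + Real.sin θ * (c j).2) - (Real.cos θ * (c i).1 + Real.sin θ * (c i).2))) :=
  ⟨@isTimeOrdered_rot_of_margins, @centres_rot⟩

end Summit.QuantumFields.YangMills.Theorems.SoftKernelBoostCovariance.Sketch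

end
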